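import Mathlib
import Summits.Ventures.HodgeRepro.Tier4.Line1.RTFSetting
import Summits.Ventures.HodgeRepro.Tier4.Line1.RealisedSetting
import Summits.Ventures.HodgeRepro.Tier4.Line1.ArchMatrixCoeff
import Summits.Ventures.HodgeRepro.Tier4.Line1.FinLevelCompact
import Summits.Ventures.HodgeRepro.Tier4.Line1.TotallyDefiniteCompact
import Summits.Ventures.HodgeRepro.Tier4.Line1.FiniteLevelIsolation
import Summits.Ventures.HodgeRepro.Tier4.Line1.OpenInvariantScope
import Summits.Ventures.HodgeRepro.Tier4.Line1.IsolatingTestsFiniteRankType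

/-!
# Tier4/Line1/TotallyDefiniteBridge — the displayed clause `IsCompact (archImage W)` follows from p2's
`IsTotallyDefinite W`; the (S1b) bridge in the `IsTotallyDefinite` form of t4-plan-1's statement (S14053)

Blind re-derivation cell `pub-hodge-repro`, Tier 4 (README §9–§10), seat t4-L1-p4 (gen 4), LINE L1.  Target tree path
`lean/Summits/Ventures/HodgeRepro/Tier4/Line1/TotallyDefiniteBridge.lean`.  Imports p2's TotallyDefiniteCompact
(`IsTotallyDefinite`, `isCompact_finLevel_of_totallyDefinite`) and this seat's OpenInvariantScope
(`archImage_subset_image_finLevel`, `continuous_infPartMat_mat`) / FiniteLevelIsolation (`exists_level_isolating`) /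
IsolatingTestsFiniteRankType (`exists_isolating_tests_finiteRankType`, `defined_inputs_realisable_finiteRankType`).
0 print.

WHAT IS PROVED.  `isCompact_archImage_of_isCompact_finLevel`: the archimedean image is the continuous image of any
compact `K_f(N) × G_∞` under the archimedean-part map (both inclusions are in OpenInvariantScope / FinLevelCompact), so
it is compact as soon as one level is.  Hence `isCompact_archImage_of_totallyDefinite`: on a totally definite plane
(p2's `IsTotallyDefinite W`: `k` totally real and the form definite at EVERY real place) the archimedean image is
compact — the one-line bridge between the two displayed clauses of the (S1b) row (t4-plan-1 S14053 / S14090).  Then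
the three theorems of record in the `IsTotallyDefinite` form: `exists_level_isolating_of_totallyDefinite` (F2″),
`exists_isolating_tests_finiteRankType_of_totallyDefinite` and **`defined_inputs_realisable_finiteRankType_of_totallyDefinite`**
(= S14053's `defined_inputs_realisable_finiteType` with `htot : IsTotallyDefinite W` displayed, `hW` kept separate
as in the skeleton).  Nothing here says anything about the status of the Hodge conjecture for CM abelian varieties,
which is NOT proved (HC_CM is NOT proved by anyone in this repository).
-/

set_option autoImplicit false

noncomputable section

namespace Summit.Ventures.HodgeRepro.Tier4.Line1

open NumberField Common MeasureTheory Topology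
open scoped Pointwise

section ArchImage

variable {k : Type} [Field k] [NumberField k] (W : PlaneData k)

/-- **the archimedean image is compact as soon as one level `K_f(N) × G_∞` is**: it is the continuous image of that
level under the archimedean-part map (`archImage_subset_image_finLevel` and `infPartMat_mem_archImage`). -/
theorem isCompact_archImage_of_isCompact_finLevel {N : ℕ} (hK : IsCompact (finLevel W N : Set (GA W))) :
    IsCompact (archImage W) := by
  have heq : archImage W = (fun g : GA W => infPartMat k (GA.mat W g)) '' (finLevel W N : Set (GA W)) := by
    refine Set.Subset.antisymm (archImage_subset_image_finLevel W N) ?_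
    rintro _ ⟨g, -, rfl⟩
    exact infPartMat_mem_archImage W g
  rw [heq]
  exact hK.image (continuous_infPartMat_mat W)

/-- **on a totally definite plane the archimedean image is compact** (p2's `isCompact_finLevel_of_totallyDefinite` at
level `1`): the bridge from the displayed clause `IsTotallyDefinite W` to the displayed clause
`IsCompact (archImage W)` of this seat's F2″ / F2‴ / (S1b-BRIDGE) theorems. -/
theorem isCompact_archImage_of_totallyDefinite (htot : IsTotallyDefinite W) : IsCompact (archImage W) :=
  isCompact_archImage_of_isCompact_finLevel W (isCompact_finLevel_of_totallyDefinite W htot one_ne_zero)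

end ArchImage

section Instance

variable {k : Type} [Field k] [NumberField k] (W : PlaneData k) [MeasurableSpace (GA W)] [BorelSpace (GA W)]
  (hW : IsDefinite W) (hg : IsGenuineRow W) (R : RTFData W) (μ : Measure (GA W)) [μ.IsHaarMeasure]
  [R.μT.IsHaarMeasure] [R.μT'.IsHaarMeasure] (hT : IsCompact (closure R.DT)) (hT' : IsCompact (closure R.DT'))

/-- F2″ (FiniteLevelIsolation's `exists_level_isolating`) with `IsTotallyDefinite W` displayed. -/
theorem exists_level_isolating_of_totallyDefinite (htot : IsTotallyDefinite W) (γ₀ : rationalPoints W)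
    (hreg : IsLinRegular W γ₀) :
    ∃ N : ℕ, N ≠ 0 ∧ ∀ t ∈ closure (Setting.ofAdelic W hW hg R μ hT hT').DT,
      ∀ t' ∈ closure (Setting.ofAdelic W hW hg R μ hT hT').DT', ∀ γ : (Setting.ofAdelic W hW hg R μ hT hT').Gk,
        (t : GA W)⁻¹ * γ * t' ∈ (γ₀ : GA W) • (finLevel W N : Set (GA W)) →
        (Setting.ofAdelic W hW hg R μ hT hT').orbitOf γ = (Setting.ofAdelic W hW hg R μ hT hT').orbitOf γ₀ :=
  exists_level_isolating W hW hg R μ hT hT' (isCompact_archImage_of_totallyDefinite W htot) γ₀ hreg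

/-- (S1b-BRIDGE) with `IsTotallyDefinite W` displayed: J2's isolating pair with `f₁` of finite-rank
left-`finLevel W N`-type. -/
theorem exists_isolating_tests_finiteRankType_of_totallyDefinite (htot : IsTotallyDefinite W)
    (hc : Continuous R.chi) (hu : ∀ a, ‖R.chi a‖ = 1) (hc' : Continuous R.chi') (hu' : ∀ a, ‖R.chi' a‖ = 1) :
    ∃ (N : ℕ) (f₁ f₂ : GA W → ℂ) (o₀ : (Setting.ofAdelic W hW hg R μ hT hT').Orbit), N ≠ 0 ∧
      RTF.IsTest f₁ ∧ RTF.IsTest f₂ ∧ RTF.IsTest ((Setting.ofAdelic W hW hg R μ hT hT').conv f₁ f₂) ∧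
      (Setting.ofAdelic W hW hg R μ hT hT').geoSupport ((Setting.ofAdelic W hW hg R μ hT hT').conv f₁ f₂) = {o₀} ∧
      (Setting.ofAdelic W hW hg R μ hT hT').orbital R.chi R.chi' o₀
        ((Setting.ofAdelic W hW hg R μ hT hT').conv f₁ f₂) ≠ 0 ∧
      RTF.HasFiniteRankLeftType (finLevel W N) f₁ :=
  exists_isolating_tests_finiteRankType W hW hg R μ hT hT' (isCompact_archImage_of_totallyDefinite W htot)
    hc hu hc' hu'

/-- **The DEFINED block of the residual in the (S1b) shape, `IsTotallyDefinite W` displayed** — t4-plan-1's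
`defined_inputs_realisable_finiteType` (S14053) word for word (`hW` kept separate). -/
theorem defined_inputs_realisable_finiteRankType_of_totallyDefinite (htot : IsTotallyDefinite W)
    (hc : Continuous R.chi) (hu : ∀ a, ‖R.chi a‖ = 1) (hc' : Continuous R.chi') (hu' : ∀ a, ‖R.chi' a‖ = 1) :
    ∃ (τ : ℕ → Set (GA W → ℂ)) (φ : ℕ → GA W → ℂ) (n : ℕ → ℕ),
      (Setting.ofAdelic W hW hg R μ hT hT').IsAdaptedONB τ φ n ∧
      ∃ (N : ℕ) (f₁ f₂ : GA W → ℂ) (o₀ : (Setting.ofAdelic W hW hg R μ hT hT').Orbit), N ≠ 0 ∧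
        RTF.IsTest f₁ ∧ RTF.IsTest f₂ ∧ RTF.IsTest ((Setting.ofAdelic W hW hg R μ hT hT').conv f₁ f₂) ∧
        (Setting.ofAdelic W hW hg R μ hT hT').geoSupport ((Setting.ofAdelic W hW hg R μ hT hT').conv f₁ f₂) = {o₀} ∧
        (Setting.ofAdelic W hW hg R μ hT hT').orbital R.chi R.chi' o₀
          ((Setting.ofAdelic W hW hg R μ hT hT').conv f₁ f₂) ≠ 0 ∧
        RTF.HasFiniteRankLeftType (finLevel W N) f₁ :=
  defined_inputs_realisable_finiteRankType W hW hg R μ hT hT' (isCompact_archImage_of_totallyDefinite W htot)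
    hc hu hc' hu'

end Instance

end Summit.Ventures.HodgeRepro.Tier4.Line1

end
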